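import Summits.BirchSwinnertonDyer.BirchSwinnertonDyer.Theorems.AdditiveBranchIMCTwistTypePartnerDataOdd
import Summits.BirchSwinnertonDyer.BirchSwinnertonDyer.Theorems.ManinLocalTwoThreeUnramifiedTwistReduction
import Summits.BirchSwinnertonDyer.BirchSwinnertonDyer.Theorems.ManinLocalTwoThreeQuadraticTwistAtTwoConductorBarriosRows
import HarnessLib

/-!
# Route `AdditiveBranchIMC` (rung K1), crux 19357 `GordTwoRankZeroOffCaseOne`, line `three_field_road`: the SEMISTABLE PARTNER,
# DYADIC FORM (an additive `2` of quadratic-twist type allowed; LEAD g14)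

Sequel of `AdditiveBranchIMCTwistTypePartnerDataOdd.lean` (p754570, LEAD g13). THEOREMS ONLY. There the curve `E` had NO additive
reduction above `2` and every odd additive prime `ℓ ≠ p` of quadratic-twist type, and the semistable partner was `V₀ ≅ E^{(p*·d)}`,
`d = ∏ ℓ*`. Here an ADDITIVE `2` OF QUADRATIC-TWIST TYPE is allowed as well: `E^{(t)}` not additive at `2` for some `t ∈ {−1, 2, −2}`
(hypothesis `h2tt`; Kodaira types of a twist of a `2`-semistable curve by `ℚ(√−1)`, `ℚ(√±2)`). The partner is then `V₀ ≅ E^{(p*·d)}` with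
`d = t · ∏_{ℓ odd} ℓ*` — the twist parameter `p*·d` is no longer `≡ 1 (mod 4)` (it is `≡ 3 (mod 4)` for `t = −1`, even for `t = ±2`),
which is why the consumer reads Castella–Liu–Wan through the DYADIC semistable-twist reading (`…_semistableTwistDyadic`, LEAD g14).

* `exists_semistable_partner_data_two` — `C • E^{(p*·d)} = V₀` globally minimal, `p ∤ d`, every prime of `d` divides `N_E` and is `≠ q`,
  `N_{V₀}` square-free, `p ∤ N_{V₀}`, `ρ̄_{V₀,p}` onto, `q ∣ N_{V₀}`.

Proof = p754570's with three changes: the twist parameter at `2` is `t` (not `2*`); at the place `2` the comparison `E^{(D)}` versus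
`E^{(t)}` goes through the twist by `u = p*·∏ℓ* ≡ 1 (mod 4)`, which does not move `f₂`
(`ManinLocalTwoThree.conductorExponent_quadraticTwist_eq_of_emod_four_eq_one_two`); at an odd prime `ℓ ∤ D` the exponents agree for ANY `D`
(`ManinLocalTwoThree.factorization_conductorNorm_quadraticTwist_eq_of_not_dvd_odd`). BSD is proved for no curve by any of this.
References: F. Castella, Z. Liu, X. Wan, Forum Math. Sigma 10 (2022) e110, §5.2; J. H. Silverman, *AEC* VII.5 Prop. 5.1, X.5 Cor. 5.4;
*ATAEC* IV.9.4, IV.10.2.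
-/

set_option linter.dupNamespace false
set_option autoImplicit false

noncomputable section

open scoped Classical

open WeierstrassCurve NumberField IsDedekindDomain Rat.HeightOneSpectrum
  Literature.NumberTheory.EllipticCurves Literature.NumberTheory.EllipticCurves.ModularForms
  Literature.NumberTheory.EllipticCurves.Rank1Residual
  Summit.BirchSwinnertonDyer.Rank1Residual Summit.BirchSwinnertonDyer.Rank1Residual.Additive
  Summit.BirchSwinnertonDyer.BirchSwinnertonDyer.Theorems

namespace Summit.BirchSwinnertonDyer.BirchSwinnertonDyer.Theorems.TwistTypePartnerData

variable (W : WeierstrassCurve ℚ) [W.IsElliptic] [W.IsGloballyMinimal] (p : ℕ) [hp : Fact p.Prime]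

/-- `natGenerator` of the place of `ℤ` under a prime is that prime. [folklore] -/
private theorem natGenerator_symm₂ (r : Nat.Primes) : natGenerator ((primesEquiv (R := ℤ)).symm r) = r :=
  congrArg (fun r : Nat.Primes ↦ (r : ℕ)) ((primesEquiv (R := ℤ)).apply_symm_apply r)

/-- `ℓ* = (−1)^{(ℓ−1)/2} ℓ ≡ 1 (mod 4)` for an odd prime `ℓ`. [folklore] -/
private theorem star_emod_four₂ {ℓ : ℕ} (hℓ : ℓ.Prime) (hℓ2 : ℓ ≠ 2) : ((-1 : ℤ) ^ (ℓ / 2) * ℓ) % 4 = 1 := by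
  haveI : Fact ℓ.Prime := ⟨hℓ⟩
  exact AdditiveKoly.RamifiedHabitat.pStar_emod_four (p := ℓ) hℓ2

/-- A product of integers `≡ 1 (mod 4)` is `≡ 1 (mod 4)`. [folklore] -/
private theorem prod_emod_four₂ {ι : Type*} (S : Finset ι) (f : ι → ℤ) (hf : ∀ i ∈ S, f i % 4 = 1) :
    (∏ i ∈ S, f i) % 4 = 1 := by
  induction S using Finset.induction_on with
  | empty => simp
  | insert a S ha ih =>
    rw [Finset.prod_insert ha, Int.mul_emod, hf a (Finset.mem_insert_self a S),
      ih (fun i hi ↦ hf i (Finset.mem_insert_of_mem hi))]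
    norm_num

/-- **The semistable partner of a curve whose additive primes other than `p` are of quadratic-twist type — `2` INCLUDED.** Let `E/ℚ`
(globally minimal `W`) lie on the cell (G-ord, `e = 2`) at `p ≥ 5` with `ρ̄_{E,p}` onto, every ODD additive prime `ℓ` of quadratic-twist
type (`htt`: `E^{(ℓ*)}` not additive at `ℓ`) and, if `E` is additive at `2`, `E^{(t)}` not additive at `2` for some `t ∈ {−1, 2, −2}`
(`h2tt`), and let `q ≠ p` be a prime of multiplicative reduction. Then for `d := t · ∏_{ℓ odd} ℓ*` over the additive primes `ℓ ≠ p`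
(`t := 1` if `E` is semistable at `2`) there is a globally minimal `V₀` with `C • E^{(p*·d)} = V₀`, `p ∤ d`, every prime of `d` divides
`N_E` and is `≠ q`, `N_{V₀}` SQUARE-FREE, `p ∤ N_{V₀}`, `ρ̄_{V₀,p}` onto and `q ∣ N_{V₀}`.
[cite: CastellaLiuWan2022, §5.2 «Our setup» (Forum Math. Sigma 10 (2022) e110)] [cite: SilvermanAEC2009, VII.5 Prop. 5.1; X.5 Cor. 5.4]
[cite: Silverman1994, IV.9.4 and IV.10.2] -/
theorem exists_semistable_partner_data_two (hp5 : 5 ≤ p) (hcell : N10.CellGordTwo W p) (hsurj : Surj W p)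
    (h2tt : ∀ r : Nat.Primes, (r : ℕ) = 2 → W.HasAdditiveReductionAt ((primesEquiv (R := ℤ)).symm r) →
      ∃ t : ℤ, (t = -1 ∨ t = 2 ∨ t = -2) ∧ ¬ (W.quadraticTwist (t : ℚ)).HasAdditiveReductionAt ((primesEquiv (R := ℤ)).symm r))
    (htt : ∀ r : Nat.Primes, (r : ℕ) ≠ 2 → W.HasAdditiveReductionAt ((primesEquiv (R := ℤ)).symm r) →
      ¬ (W.quadraticTwist (((-1 : ℤ) ^ ((r : ℕ) / 2) * r : ℤ) : ℚ)).HasAdditiveReductionAt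
        ((primesEquiv (R := ℤ)).symm r))
    {q : ℕ} [hq : Fact q.Prime] (hqp : q ≠ p) (hmq : W.HasMultiplicativeReductionAtPrime q) :
    ∃ (V : WeierstrassCurve ℚ) (_ : V.IsElliptic) (_ : V.IsGloballyMinimal) (C : VariableChange ℚ) (d : ℤ),
      C • W.quadraticTwist ((-1 : ℚ) ^ (p / 2) * p * d) = V ∧ ¬ (p : ℤ) ∣ d ∧
      (∀ ℓ : ℕ, ℓ.Prime → (ℓ : ℤ) ∣ d → ℓ ∣ W.conductorNorm ℤ ∧ ℓ ≠ q) ∧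
      Squarefree (V.conductorNorm ℤ) ∧ ¬ p ∣ V.conductorNorm ℤ ∧ Surj V p ∧ q ∣ V.conductorNorm ℤ := by
  have hpr : p.Prime := hp.out
  have hqr : q.Prime := hq.out
  have hp2 : p ≠ 2 := by omega
  set N := W.conductorNorm ℤ with hN
  have hN0 : N ≠ 0 := (W.conductorNorm_pos_holds).ne'
  set P2 : Nat.Primes := ⟨2, Nat.prime_two⟩ with hP2
  set v₂ : HeightOneSpectrum ℤ := (primesEquiv (R := ℤ)).symm P2 with hv₂
  have hv₂2 : natGenerator v₂ = 2 := by rw [hv₂, natGenerator_symm₂]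
  -- the twist parameter at `2`
  obtain ⟨t, ht, htadd⟩ : ∃ t : ℤ, (t = 1 ∨ t = -1 ∨ t = 2 ∨ t = -2) ∧
      (W.HasAdditiveReductionAt v₂ → ¬ (W.quadraticTwist (t : ℚ)).HasAdditiveReductionAt v₂) := by
    by_cases h : W.HasAdditiveReductionAt v₂
    · obtain ⟨t, ht, hnt⟩ := h2tt P2 rfl h
      exact ⟨t, Or.inr ht, fun _ ↦ hnt⟩
    · exact ⟨1, Or.inl rfl, fun h' ↦ absurd h' h⟩
  have ht0 : t ≠ 0 := by rcases ht with rfl | rfl | rfl | rfl <;> norm_num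
  -- the additive primes other than `p`, read off the conductor: `ℓ ≠ p`, `ℓ² ∣ N`
  set S : Finset ℕ := N.primeFactors.filter (fun ℓ ↦ ℓ ≠ p ∧ ℓ ^ 2 ∣ N) with hS
  have hSmem : ∀ {ℓ : ℕ}, ℓ ∈ S ↔ ℓ.Prime ∧ ℓ ∣ N ∧ ℓ ≠ p ∧ ℓ ^ 2 ∣ N := by
    intro ℓ
    rw [hS, Finset.mem_filter, Nat.mem_primeFactors]
    constructor
    · rintro ⟨⟨h1, h2, -⟩, h3, h4⟩; exact ⟨h1, h2, h3, h4⟩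
    · rintro ⟨h1, h2, h3, h4⟩; exact ⟨⟨h1, h2, hN0⟩, h3, h4⟩
  have hSadd : ∀ {ℓ : ℕ} (hℓ : ℓ ∈ S),
      W.HasAdditiveReductionAt ((primesEquiv (R := ℤ)).symm ⟨ℓ, (hSmem.mp hℓ).1⟩) := by
    intro ℓ hℓ
    have h := hSmem.mp hℓ
    rw [← natGenerator_sq_dvd_conductorNorm_iff _ W, natGenerator_symm₂]
    exact h.2.2.2
  -- the twist parameters: `ℓ*` at an odd `ℓ`, `t` at `2`
  set star : ℕ → ℤ := fun ℓ ↦ if ℓ = 2 then t else (-1 : ℤ) ^ (ℓ / 2) * ℓ with hstar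
  have hstar_odd : ∀ {ℓ : ℕ}, ℓ ≠ 2 → star ℓ = (-1 : ℤ) ^ (ℓ / 2) * ℓ := fun h ↦ by simp [hstar, h]
  have hstar2 : star 2 = t := by simp [hstar]
  have hstarp : star p = (-1 : ℤ) ^ (p / 2) * p := hstar_odd hp2
  set d : ℤ := ∏ ℓ ∈ S, star ℓ with hd
  set D : ℤ := star p * d with hD
  have hstar0 : ∀ {ℓ : ℕ}, ℓ.Prime → star ℓ ≠ 0 := fun {ℓ} hℓ ↦ by
    by_cases h : ℓ = 2
    · rw [h, hstar2]; exact ht0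
    · rw [hstar_odd h]; exact mul_ne_zero (pow_ne_zero _ (by norm_num)) (by exact_mod_cast hℓ.ne_zero)
  have hdvd_self : ∀ {ℓ : ℕ}, ℓ ≠ 2 → (ℓ : ℤ) ∣ star ℓ := fun h ↦ by rw [hstar_odd h]; exact dvd_mul_left _ _
  have hdD : d ∣ D := by rw [hD]; exact dvd_mul_left d (star p)
  have hpD : (p : ℤ) ∣ D := by rw [hD]; exact (hdvd_self hp2).trans (dvd_mul_right _ _)
  have hstar4 : ∀ {ℓ : ℕ}, ℓ.Prime → ℓ ≠ 2 → star ℓ % 4 = 1 := fun hℓ h ↦ by rw [hstar_odd h]; exact star_emod_four₂ hℓ h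
  have hd0 : d ≠ 0 := Finset.prod_ne_zero_iff.mpr (fun ℓ hℓ ↦ hstar0 (hSmem.mp hℓ).1)
  have hD0 : D ≠ 0 := mul_ne_zero (hstar0 hpr) hd0
  have hDQ : (D : ℚ) ≠ 0 := by exact_mod_cast hD0
  -- prime divisors of `d` lie in `S`; prime divisors of `D` lie in `S ∪ {p}`
  have hdvd_star : ∀ {ℓ ℓ' : ℕ}, ℓ.Prime → ℓ'.Prime → (ℓ : ℤ) ∣ star ℓ' → ℓ = ℓ' := by
    intro ℓ ℓ' hℓ hℓ' h
    by_cases h2 : ℓ' = 2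
    · subst h2
      rw [hstar2] at h
      have hℓu : ¬ IsUnit (ℓ : ℤ) := fun hu ↦ by
        rcases Int.isUnit_iff.mp hu with hu | hu <;> have := hℓ.two_le <;> omega
      rcases ht with rfl | rfl | rfl | rfl
      · exact absurd (isUnit_of_dvd_one h) hℓu
      · exact absurd (isUnit_of_dvd_one ((dvd_neg).mp h)) hℓu
      · exact (Nat.prime_dvd_prime_iff_eq hℓ Nat.prime_two).mp (Int.natCast_dvd_natCast.mp h)
      · exact (Nat.prime_dvd_prime_iff_eq hℓ Nat.prime_two).mp (Int.natCast_dvd_natCast.mp ((dvd_neg).mp h))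
    · haveI : Fact ℓ'.Prime := ⟨hℓ'⟩
      rw [hstar_odd h2] at h
      exact AdditiveKoly.RamifiedHabitat.eq_of_prime_dvd_pStar (p := ℓ') hℓ h
  have hdvd_d : ∀ {ℓ : ℕ}, ℓ.Prime → (ℓ : ℤ) ∣ d → ℓ ∈ S := by
    intro ℓ hℓ h
    have hℓZ : Prime (ℓ : ℤ) := Nat.prime_iff_prime_int.mp hℓ
    obtain ⟨ℓ', hℓ'S, hℓ'⟩ := (Prime.dvd_finsetProd_iff hℓZ _).mp h
    rwa [hdvd_star hℓ (hSmem.mp hℓ'S).1 hℓ']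
  have hdvd_D : ∀ {ℓ : ℕ}, ℓ.Prime → (ℓ : ℤ) ∣ D → ℓ = p ∨ ℓ ∈ S := by
    intro ℓ hℓ h
    have hℓZ : Prime (ℓ : ℤ) := Nat.prime_iff_prime_int.mp hℓ
    rcases hℓZ.dvd_or_dvd h with h | h
    · exact Or.inl (hdvd_star hℓ hpr h)
    · exact Or.inr (hdvd_d hℓ h)
  have hpd : ¬ (p : ℤ) ∣ d := fun h ↦ (hSmem.mp (hdvd_d hpr h)).2.2.1 rfl
  have hpS : p ∉ S := fun h ↦ (hSmem.mp h).2.2.1 rfl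
  -- the twisted curve and its conductor exponents
  haveI iT : (W.quadraticTwist (D : ℚ)).IsElliptic := W.isElliptic_quadraticTwist hDQ
  set NT := (W.quadraticTwist (D : ℚ)).conductorNorm ℤ with hNT
  have hNT0 : NT ≠ 0 := ((W.quadraticTwist (D : ℚ)).conductorNorm_pos_holds).ne'
  -- (a) at primes outside `S ∪ {p}` the exponents of `E` and `E^{(D)}` agree
  have hfac : ∀ {ℓ : ℕ} (hℓ : ℓ.Prime), ℓ ≠ p → ℓ ∉ S → NT.factorization ℓ = N.factorization ℓ := by
    intro ℓ hℓ hℓp hℓS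
    by_cases hℓ2 : ℓ = 2
    · -- `E` is semistable at `2`, so `t = 1` and `D ≡ 1 (mod 4)`
      subst hℓ2
      have hS2 : ∀ ℓ' ∈ S, ℓ' ≠ 2 := fun ℓ' h h2 ↦ hℓS (h2 ▸ h)
      have hD4 : D % 4 = 1 := by
        rw [hD, Int.mul_emod, hstar4 hpr hp2, hd, prod_emod_four₂ S star (fun ℓ' h ↦ hstar4 (hSmem.mp h).1 (hS2 ℓ' h))]
        norm_num
      have h2D : ¬ ((natGenerator v₂ : ℕ) : ℤ) ∣ D := by
        rw [hv₂2]
        intro h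
        rcases hdvd_D Nat.prime_two (by exact_mod_cast h) with h | h
        · exact hp2 h.symm
        · exact hℓS h
      have h := W.factorization_conductorNorm_quadraticTwist_eq_of_not_dvd hD4 v₂ h2D
      rw [hv₂2] at h
      exact h
    · have hℓD : ¬ (ℓ : ℤ) ∣ D := fun h ↦ by
        rcases hdvd_D hℓ h with h | h
        · exact hℓp h
        · exact hℓS h
      exact ManinLocalTwoThree.factorization_conductorNorm_quadraticTwist_eq_of_not_dvd_odd W hℓ hℓ2 hℓD
  -- (b) `E^{(D)}` is not additive at the primes of `S`
  have hnaddS : ∀ {ℓ : ℕ} (hℓ : ℓ ∈ S),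
      ¬ (W.quadraticTwist (D : ℚ)).HasAdditiveReductionAt ((primesEquiv (R := ℤ)).symm ⟨ℓ, (hSmem.mp hℓ).1⟩) := by
    intro ℓ hℓ
    have hprime := (hSmem.mp hℓ).1
    set v := (primesEquiv (R := ℤ)).symm ⟨ℓ, hprime⟩ with hv
    -- `D = star ℓ · u`
    set u : ℤ := star p * ∏ ℓ' ∈ S.erase ℓ, star ℓ' with hu
    have hDu : D = star ℓ * u := by
      rw [hD, hd, hu, ← Finset.mul_prod_erase S star hℓ]; ring
    have hstarQ : ((star ℓ : ℤ) : ℚ) ≠ 0 := by exact_mod_cast hstar0 hprime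
    haveI : (W.quadraticTwist ((star ℓ : ℤ) : ℚ)).IsElliptic := W.isElliptic_quadraticTwist hstarQ
    have heq : (W.quadraticTwist ((star ℓ : ℤ) : ℚ)).quadraticTwist (u : ℚ) = W.quadraticTwist (D : ℚ) := by
      rw [quadraticTwist_quadraticTwist, hDu]; push_cast; ring
    by_cases hℓ2 : ℓ = 2
    · -- at `2`: `E^{(D)} = (E^{(t)})^{(u)}` with `u ≡ 1 (mod 4)`, and `E^{(t)}` is not additive at `2`
      subst hℓ2
      have hS2 : ∀ ℓ' ∈ S.erase 2, ℓ' ≠ 2 := fun ℓ' h ↦ Finset.ne_of_mem_erase h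
      have hu4 : u % 4 = 1 := by
        rw [hu, Int.mul_emod, hstar4 hpr hp2,
          prod_emod_four₂ (S.erase 2) star (fun ℓ' h ↦ hstar4 (hSmem.mp (Finset.mem_of_mem_erase h)).1 (hS2 ℓ' h))]
        norm_num
      have hvv : v = v₂ := by rw [hv, hv₂]
      have hadd : W.HasAdditiveReductionAt v₂ := by rw [← hvv, hv]; exact hSadd hℓ
      have hnt := htadd hadd
      haveI : (W.quadraticTwist (t : ℚ)).IsElliptic := W.isElliptic_quadraticTwist (by exact_mod_cast ht0)
      have heq2 : (W.quadraticTwist (t : ℚ)).quadraticTwist (u : ℚ) = W.quadraticTwist (D : ℚ) := by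
        rw [← heq, hstar2]
      haveI : ((W.quadraticTwist (t : ℚ)).quadraticTwist (u : ℚ)).IsElliptic := by rw [heq2]; infer_instance
      rw [← heq2, hvv, ← two_le_conductorExponent_iff_holds v₂ _,
        ManinLocalTwoThree.conductorExponent_quadraticTwist_eq_of_emod_four_eq_one_two (W.quadraticTwist (t : ℚ)) v₂ hv₂2 hu4,
        two_le_conductorExponent_iff_holds v₂ _]
      exact hnt
    · have hℓu : ¬ (ℓ : ℤ) ∣ u := by
        intro h
        have hℓZ : Prime (ℓ : ℤ) := Nat.prime_iff_prime_int.mp hprime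
        rcases hℓZ.dvd_or_dvd h with h | h
        · exact (hSmem.mp hℓ).2.2.1 (hdvd_star hprime hpr h)
        · obtain ⟨ℓ', hℓ'S, hℓ'⟩ := (Prime.dvd_finsetProd_iff hℓZ _).mp h
          have := hdvd_star hprime (hSmem.mp (Finset.mem_of_mem_erase hℓ'S)).1 hℓ'
          exact (Finset.ne_of_mem_erase hℓ'S) this.symm
      have htwℓ := htt ⟨ℓ, hprime⟩ hℓ2 (hSadd hℓ)
      have hiff := ((W.quadraticTwist ((star ℓ : ℤ) : ℚ)).hasReductionAt_quadraticTwist_iff_of_not_dvd v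
        (by rw [hv, natGenerator_symm₂]; exact hℓ2) (d := u) (by rw [hv, natGenerator_symm₂]; exact hℓu)).2.2
      rw [← heq, hiff, show ((star ℓ : ℤ) : ℚ) = (((-1 : ℤ) ^ (ℓ / 2) * ℓ : ℤ) : ℚ) by rw [hstar_odd hℓ2]]
      exact htwℓ
  -- (c) `E^{(D)}` is GOOD at `p`
  have hgoodp : (W.quadraticTwist (D : ℚ)).HasGoodReductionAt ((primesEquiv (R := ℤ)).symm ⟨p, hpr⟩) := by
    set v := (primesEquiv (R := ℤ)).symm ⟨p, hpr⟩ with hv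
    obtain ⟨Wp, iWp, iWpm, Cp, hCp⟩ := exists_isGloballyMinimal_smul_eq_quadraticTwist W (pStar_ne_zero p)
    have hWp : Cp⁻¹ • W.quadraticTwist ((-1 : ℚ) ^ (p / 2) * p) = Wp := by rw [← hCp, inv_smul_smul]
    have hgood : Wp.HasGoodReductionAtPrime p :=
      (goodOrd_twist_pStar_of_typeGOrd W p hp5 hcell.2.2.1 hcell.2.2.2 Wp ⟨Cp⁻¹, hWp⟩).1
    have hgood' : (W.quadraticTwist ((star p : ℤ) : ℚ)).HasGoodReductionAt v := by
      have hcast : ((star p : ℤ) : ℚ) = (-1 : ℚ) ^ (p / 2) * p := by rw [hstarp]; push_cast; ring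
      rw [hcast, ← hCp, hasGoodReductionAt_smul_iff_holds _ Wp Cp]
      exact (Wp.hasGoodReductionAtPrime_iff_hasGoodReductionAt_holds ⟨p, hpr⟩).mp hgood
    have hstarQ : ((star p : ℤ) : ℚ) ≠ 0 := by exact_mod_cast hstar0 hpr
    haveI : (W.quadraticTwist ((star p : ℤ) : ℚ)).IsElliptic := W.isElliptic_quadraticTwist hstarQ
    have hiff := ((W.quadraticTwist ((star p : ℤ) : ℚ)).hasReductionAt_quadraticTwist_iff_of_not_dvd v
      (by rw [hv, natGenerator_symm₂]; exact hp2) (d := d) (by rw [hv, natGenerator_symm₂]; exact hpd)).1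
    have heq : (W.quadraticTwist ((star p : ℤ) : ℚ)).quadraticTwist (d : ℚ) = W.quadraticTwist (D : ℚ) := by
      rw [quadraticTwist_quadraticTwist, hD]; push_cast; ring
    rw [← heq, hiff]
    exact hgood'
  -- (d) hence every conductor exponent of `E^{(D)}` is `≤ 1`, and `f_p = 0`
  have hfacp : NT.factorization p = 0 := by
    have h : ¬ natGenerator ((primesEquiv (R := ℤ)).symm ⟨p, hpr⟩) ∣ NT :=
      fun h ↦ ((natGenerator_dvd_conductorNorm_iff _ (W.quadraticTwist (D : ℚ))).mp h) hgoodp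
    rw [natGenerator_symm₂] at h
    exact Nat.factorization_eq_zero_of_not_dvd h
  have hle : ∀ ℓ : ℕ, NT.factorization ℓ ≤ 1 := by
    intro ℓ
    by_cases hℓ : ℓ.Prime
    · by_cases hℓp : ℓ = p
      · rw [hℓp, hfacp]; exact zero_le_one
      by_cases hℓS : ℓ ∈ S
      · -- not additive at `ℓ ∈ S` ⟹ `ℓ² ∤ N_T`
        have hnsq : ¬ ℓ ^ 2 ∣ NT := by
          have h := (not_congr (natGenerator_sq_dvd_conductorNorm_iff ((primesEquiv (R := ℤ)).symm ⟨ℓ, hℓ⟩)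
            (W.quadraticTwist (D : ℚ)))).mpr (hnaddS hℓS)
          rwa [natGenerator_symm₂] at h
        by_contra hgt
        exact hnsq ((hℓ.pow_dvd_iff_le_factorization hNT0).mpr (by omega))
      · rw [hfac hℓ hℓp hℓS]
        have hnsq : ¬ ℓ ^ 2 ∣ N := fun hsq ↦ hℓS (hSmem.mpr ⟨hℓ, (dvd_pow_self ℓ two_ne_zero).trans hsq, hℓp, hsq⟩)
        by_contra hgt
        exact hnsq ((hℓ.pow_dvd_iff_le_factorization hN0).mpr (by omega))
    · rw [Nat.factorization_eq_zero_of_not_prime _ hℓ]; exact zero_le_one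
  have hsqT : Squarefree NT := (Nat.squarefree_iff_factorization_le_one hNT0).mpr hle
  -- `q ∉ S ∪ {p}`: `f_q(E^{(D)}) = f_q(E) = 1`
  have hq2N : ¬ q ^ 2 ∣ N := by
    rw [hqr.pow_dvd_iff_le_factorization hN0, W.factorization_conductorNorm_eq_one_of_hasMultiplicativeReductionAtPrime q hmq]
    omega
  have hqS : q ∉ S := fun h ↦ hq2N (hSmem.mp h).2.2.2
  have hfacq : NT.factorization q = 1 := by
    rw [hfac hqr hqp hqS, W.factorization_conductorNorm_eq_one_of_hasMultiplicativeReductionAtPrime q hmq]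
  -- the globally minimal model
  obtain ⟨V, iV, iVm, C, hC⟩ := exists_isGloballyMinimal_smul_eq_quadraticTwist W hDQ
  have hNV : V.conductorNorm ℤ = NT := by rw [hNT, ← hC, conductorNorm_smul_rat]
  have hcast : (D : ℚ) = (-1 : ℚ) ^ (p / 2) * p * d := by rw [hD, hstarp]; push_cast; ring
  have hCV : C⁻¹ • W.quadraticTwist ((-1 : ℚ) ^ (p / 2) * p * d) = V := by
    rw [← hcast, ← hC, inv_smul_smul]
  refine ⟨V, iV, iVm, C⁻¹, d, hCV, hpd, ?_, ?_, ?_, ?_, ?_⟩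
  · -- primes of `d`
    intro ℓ hℓ hℓd
    have hℓS := hdvd_d hℓ hℓd
    exact ⟨(hSmem.mp hℓS).2.1, fun h ↦ hqS (h ▸ hℓS)⟩
  · rw [hNV]; exact hsqT
  · rw [hNV]
    intro h
    have h1 := (hpr.dvd_iff_one_le_factorization hNT0).mp h
    rw [hfacp] at h1
    exact absurd h1 (by norm_num)
  · exact (surj_iff_of_model_twist W p (d := (-1 : ℚ) ^ (p / 2) * p * d) (by rw [← hcast]; exact hDQ) ⟨C⁻¹, hCV⟩).mpr hsurj
  · rw [hNV]; exact (hqr.dvd_iff_one_le_factorization hNT0).mpr (by rw [hfacq])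

end Summit.BirchSwinnertonDyer.BirchSwinnertonDyer.Theorems.TwistTypePartnerData

end
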